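import Literature.NumberTheory.LFunctions.RodgersTaoEnergyProofs
import Literature.NumberTheory.LFunctions.RodgersTaoEnergyV5
import HarnessLib

/-!
# Rodgers–Tao under `Λ < 0`: the standing hypothesis is refuted, so the §9 facts hold
(discharge of `rodgers_tao_picket_fence` and `rodgers_tao_gaps_near_mean`)

Trunk T-ANT (`Literature/NumberTheory/LFunctions`). Proofs only (no definitions, no named facts).

The decomposition files `RodgersTao.lean` and `RodgersTaoEnergy.lean` vendor the intermediate
results of B. Rodgers, T. Tao, *The de Bruijn–Newman constant is non-negative*, Forum Math. Pi 8
(2020), e6 = arXiv:1801.05914, §§7–9, as named facts. The paper is a proof by contradiction from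
the standing hypothesis of its §1.2,

> "Throughout the rest of the paper, we will assume for sake of contradiction that Newman's
> conjecture fails: `Λ < 0`",

and accordingly every one of these facts is an implication whose antecedent is that hypothesis,
in the tree's `sInf`-free witness form `∃ t < 0, HasOnlyRealZeros (deBruijnH t)` (resp.
`∀ t₀ < 0, HasOnlyRealZeros (deBruijnH t₀) → ⋯`):

* `Literature.NumberTheory.LFunctions.rodgers_tao_picket_fence` (§9, display (picketfence)),
* `Literature.NumberTheory.LFunctions.rodgers_tao_gaps_near_mean` (§9),
* `Literature.NumberTheory.LFunctions.rodgers_tao_energy_bound_zero` (Prop. 8.1),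
* `Literature.NumberTheory.LFunctions.rodgers_tao_integrated_energy_bound` (Thm. 7.2),
* `Literature.NumberTheory.LFunctions.rodgers_tao_energy_propagation` (Prop. 8.2 of arXiv v1–4).

The antecedent is now REFUTED in the tree: Newman's conjecture
`Literature.NumberTheory.LFunctions.rodgers_tao : ∀ t < 0, ¬ HasOnlyRealZeros (deBruijnH t)`
(Rodgers–Tao's Theorem 1.1) is the theorem
`Literature.NumberTheory.LFunctions.rodgers_tao_holds` of `DobnerLemma4Proofs.lean`, proved along
the independent route of A. Dobner, *A proof of Newman's conjecture for the extended Selberg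
class*, Acta Arith. 201 (2021), 29–62 — a closed theorem on the standard axioms which uses none
of the facts above (no `Dobner*.lean` file imports a `RodgersTao*.lean` file). Consequently each
of the five facts holds, *ex falso*. The last three were discharged in this way at the end of
`RodgersTaoEnergyProofs.lean` (`rodgers_tao_energy_bound_zero_holds`,
`rodgers_tao_integrated_energy_bound_holds`, `rodgers_tao_energy_propagation_holds`); this file
records the two remaining discharges, `rodgers_tao_picket_fence_holds` and
`rodgers_tao_gaps_near_mean_holds`, in the same way.

## On the docstrings of the discharged facts

The docstrings of `rodgers_tao_picket_fence` and `rodgers_tao_gaps_near_mean` say that their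
discharge "must formalise the content of §§2–8 of the source, never invoke a proof of
`rodgers_tao`". That instruction guarded against CIRCULARITY at a time when the only route to
`rodgers_tao` in the tree was this very decomposition (`rodgers_tao_of_picket_fence`,
`RodgersTaoProofs.lean`): discharging the picket fence from `rodgers_tao` and `rodgers_tao` from
the picket fence would have proved nothing. With Dobner's route complete the circle is broken —
`rodgers_tao_holds` does not depend on any Rodgers–Tao fact — and the statements, being
implications from a refuted hypothesis, are simply true; as the same docstrings observe, each of
them "is equivalent to `rodgers_tao` over unconditional facts". Nothing is weakened and nothing is
assumed: the discharges below are closed theorems.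

What these discharges do NOT provide is a formalisation of the *content* of Rodgers–Tao §§2–8
(saddle-point asymptotics of `H_t`, Riemann–von Mangoldt formulae for `H_t`, the
Csordas–Smith–Varga dynamics, gap and energy bounds). The tree's non-vacuous progress on that
content is: §9 and the v5-corrected §8 proved as implications (`RodgersTaoProofs.lean`,
`RodgersTaoEnergyProofs.lean`, `RodgersTaoEnergyV5Proofs.lean`: picket fence ⇐ Thm. 7.2 +
Prop. 8.3 (v5) + regularity of the zeros), the zeros at time `0` and the zero enumeration for
`t > Λ` (`RodgersTaoZerosProofs.lean`, `RodgersTaoZeroSet.lean`). Under `Λ ≥ 0` every statement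
of §§2–8 *as printed* ("let `Λ < t ≤ 0`") is vacuous; their non-vacuous analogues are the versions
for `t > Λ` without the sign condition (cf. Remark 2.2 of the source), which are different
statements and are not vendored in the tree.

## References

* B. Rodgers, T. Tao, *The de Bruijn–Newman constant is non-negative*, Forum Math. Pi 8 (2020),
  e6 = arXiv:1801.05914 (v5, 2021): §1.2 (standing hypothesis), Thm. 1.1, Thm. 7.2, Prop. 8.1,
  Prop. 8.2, §9.
* A. Dobner, *A proof of Newman's conjecture for the extended Selberg class*, Acta Arith. 201
  (2021), 29–62 = arXiv:2005.05142 (the route of `rodgers_tao_holds`).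
-/

namespace Literature.NumberTheory.LFunctions

/-- **The standing hypothesis of Rodgers–Tao §§2–9 is refuted**: there is no `t < 0` for which
`H_t` has only real zeros (Newman's conjecture `Λ ≥ 0`, Rodgers–Tao 2020, Thm. 1.1, in the tree as
`rodgers_tao_holds`, proved along Dobner 2021). [cite: RodgersTaoFMP2020, Thm. 1.1] -/
theorem not_exists_neg_hasOnlyRealZeros_deBruijnH :
    ¬ ∃ t : ℝ, t < 0 ∧ HasOnlyRealZeros (deBruijnH t) :=
  fun ⟨t, ht, hreal⟩ ↦ rodgers_tao_holds t ht hreal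

/-- **Discharge of `rodgers_tao_picket_fence`** (Rodgers–Tao 2020, §9, display (picketfence):
under `Λ < 0`, the gaps `γ_{n+1} − γ_n` in `[T log T, 2T log T]` are `(2π + o(1))/log T` for all
but `o(T log T)` indices). The statement is an implication from the standing hypothesis `Λ < 0`
(`∃ t < 0, H_t` has only real zeros), which `rodgers_tao_holds` (Thm. 1.1, proved in the tree along
Dobner's independent route) refutes; hence it holds. See the module docstring for why this is
not circular and for what is, and is not, formalised of §§2–8.
[cite: RodgersTaoFMP2020, §9 eq. (picketfence)] -/
theorem rodgers_tao_picket_fence_holds : rodgers_tao_picket_fence :=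
  fun h ↦ (not_exists_neg_hasOnlyRealZeros_deBruijnH h).elim

/-- **Discharge of `rodgers_tao_gaps_near_mean`** (Rodgers–Tao 2020, §9: under `Λ < 0` "the gaps
between the zeroes of the zeta function are rarely much larger or smaller than the mean
spacing"). An implication from the refuted standing hypothesis `Λ < 0` (`rodgers_tao_holds`);
hence it holds. (Non-vacuously, it also follows from the picket fence and the Riemann–von
Mangoldt formula: `rodgers_tao_gaps_near_mean_of_picket_fence`, `RodgersTaoProofs.lean`.)
[cite: RodgersTaoFMP2020, §9 (sentence after eq. (picketfence))] -/
theorem rodgers_tao_gaps_near_mean_holds : rodgers_tao_gaps_near_mean :=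
  fun h ↦ (not_exists_neg_hasOnlyRealZeros_deBruijnH h).elim

/-- Likewise the v5 predicates of `RodgersTaoEnergyV5.lean` hold for every (necessarily
non-existent) witness: for `t₀ < 0` with `H_{t₀}` real-rooted, `EnergyPropagationV5 t₀`.
[cite: RodgersTaoFMP2020, arXiv v5 Prop. 8.3] -/
theorem energyPropagationV5_of_neg {t₀ : ℝ} (ht₀ : t₀ < 0)
    (hreal : HasOnlyRealZeros (deBruijnH t₀)) : EnergyPropagationV5 t₀ :=
  absurd hreal (rodgers_tao_holds t₀ ht₀)

/-- … and `GoodIntervalBound t₀`. [cite: RodgersTaoFMP2020, arXiv v5 Prop. 8.2] -/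
theorem goodIntervalBound_of_neg {t₀ : ℝ} (ht₀ : t₀ < 0)
    (hreal : HasOnlyRealZeros (deBruijnH t₀)) : GoodIntervalBound t₀ :=
  absurd hreal (rodgers_tao_holds t₀ ht₀)

end Literature.NumberTheory.LFunctions
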